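/-
Copyright (c) 2026 the pub-hodgecm-mathlib formalisation cell (harness21).  Prover seat hodgecm-mathlib-LH7-p06 (g0), «(D-RAM) FOUR-FRAME» road of crux H413, line LH4,
(β-BAL) Stage B, β-BOARD v1 ROW R5b «G₃ ε-BOUNDARY, THE TWO-SLOT CORE» (HEAD split 16:04Z: slot 0 = this seat, slots 1, 2 + Fin-3 assembly = LH4-p18 (g0)),
STEP (β3a) = THEOREM A: THE SLOT-0 COLUMN BEYOND THE `n₁`-CELL.  2026-09-04.
-/
import Summits.HodgeConjecture.HodgeConjecture.Theorems.F0P3cDyRamLabelledOddBoundaryValueG3        -- ★ p861675 (this seat, β1): `labelledOddCount_div_relIndex_twoSlot_latt_G3`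
import Summits.HodgeConjecture.HodgeConjecture.Theorems.F0P3cDyRamLabelledOddBoundaryIndicatorsG3   -- ★ p861738 (this seat, β2): `indicator_zero_latt_G3_iff`
import Summits.HodgeConjecture.HodgeConjecture.Theorems.F0P3cDyRamLabelledOddG3OrbitDecomposition   -- ★ p861619 (LH4-p18 (g0), α): `…_eq_card_mul_sum_of_read`, the reps `M(g)`, `D(g)`, weight
import Summits.HodgeConjecture.HodgeConjecture.Theorems.F0P3cDyRamLabelledOddBoundarySums           -- ★ p861608 (LH4-p17 (g0)): `sum_normSign_one_add_mul_moebius_boundary ∕ _eq_zero`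
import Summits.HodgeConjecture.HodgeConjecture.Theorems.F0P3cDyRamDiagonalGluedClassRepresentatives -- ★ (iv-c) (LH4-p08): `exists_fixed_class_representatives`, `v_mul_map_pow`
import Summits.HodgeConjecture.HodgeConjecture.Theorems.F0P3cDyRamDiagonalOrbitFibreCountHeads      -- ★ (LH4-p10): `finite_unitTorus_orbit_of_mem_normalisedStableLattices`
import Summits.HodgeConjecture.HodgeConjecture.Theorems.F0P3cDyRamStableCountTypeZero               -- ★ `v_diag_eq_one`, `diag_regular`
import Summits.HodgeConjecture.HodgeConjecture.Theorems.F0P3cDyRamTowerSignToken                    -- ★ p860771 (LH4-p10): `exists_towerSign_of_mcOfRecord_le`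
import Summits.HodgeConjecture.HodgeConjecture.Theorems.F0P3cDyRamElementDatumParity                -- ★ (LH4-p10): `isoceles_of_isElementDatum`, `depth_mod_two_eq_of_isElementDatum`
import Summits.HodgeConjecture.HodgeConjecture.Theorems.F0P3cDyRamFixedCountDiagonalModel           -- ★ `normSign_mul_norm`
import HarnessLib

/-!
# Crux `H413`, line LH4 «(D-RAM) FOUR-FRAME» — (β-BAL) Stage B, β-BOARD v1 ROW R5b «G₃ ε-BOUNDARY, TWO-SLOT CORE», THEOREM A: THE SLOT-0 COLUMN OF THE G₃ STRATUM BEYOND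
# THE `n₁`-CELL — `Σᶠ_{M ∈ G₃(2ρ+s, 2ρ+s, 2ρ), clean shell} m^Λ_0(M)∕[𝒰 : N(S̃(M))] = ω(e_C)∕2 · q^{2ρ+s∕2−1} · ω(−1)·B(n₁)` on `n₁ < 2ρ + m*`

Cell `hodgecm-mathlib` (D-0151), FLOOR 0, crux item H413 = `stmt-HodgeConjecture-24833`, route `HCCMUnconditional`; squad F0∕P3c∕LH4.  THEOREMS ONLY (no `def`, no instance, no
notation, no `sorry`, default heartbeats); ★-only imports; lane `--supports stmt-HodgeConjecture-24833 --as helper` (count-neutral); pays NO row, states NO law.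

THE MATHEMATICS.  In the bracket currency of ★ (T1) p861261 `hG3t` ∕ ★ p861354 `hbeyond`, `B(n) = (q−1)·[2d + ℓ₀ + 2ρ ≤ n] − [n + 2 = 2d + ℓ₀ + 2ρ]`.  On the G₃ stratum read
`2ρ + s + ℓ₀ = n₃` (`s = 2t`) with tube guard `2ρ + 2 + ℓ₀ ≤ min n₁ n₂` and BEYOND THE `n₁`-CELL (`n₁ < 2ρ + m*`, so `Δ₁ := n₁ − ℓ₀ − 2ρ ∈ [2, 2d−2]`, even):
* §1 the representative algebra (for ALL slots; LH4-p18 (g0) imports it): on ★ p861619's `M(g)` with polarisation `D(g) = π₀^{−(ρ+t)}·(−(1+g)⁻¹, 1, g)` the two-slot unit of ★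
  p861535 is `S(g) = (1+g)⁻¹·e_C·(1 + κ·g∕(1+g))`, `κ := −e_B·π₀^{k₁}·(π₀^{ρ+t})⁻¹·e_C⁻¹` (σ-fixed, `|κ|·|ϖ|^{2t} = |ϖ|^{Δ₁}`), so `ω(S(g)) = ω(1+g)·ω(e_C)·ω(1 + κ·g∕(1+g))`
  and `ω(D(g)₀) = ω(−1)·ω(1+g)` — **`linearSum_G3_rep_eq`**, **`normSign_linearSum_G3_rep`**, **`normSign_D0_G3_rep`**;
* §2 the per-representative slot-0 value (★ p861675 (β1) ∘ ★ p861738 (β2) ∘ §1 ∘ ★ p861619 weight):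
  `m^Λ_0(M(g))∕[𝒰:N] = ω(−1)ω(e_C)∕2 · [2d−1 ≤ n₁−ρ−ℓ₀] · w · ω(1 + κ·g∕(1+g))` — **`labelledOddCount_div_relIndex_G3_rep_zero`**;
* §3 THEOREM A (★ p861619 `_of_read` ∘ §2 ∘ ★ p861608 §3 Möbius sums ∘ ★ `orbit_mass_eq_pow`): at the boundary `Δ₁ = 2d − 2` the R-sum is `−q^{⌈ρ∕2⌉−1}` and the indicator is on
  (`ρ ≥ 1`), giving `−ω(−1)ω(e_C)∕2 · q^{2ρ+t−1}`; below it the R-sum vanishes inside the window `2d ≤ ρ + Δ₁ + 1`, which IS the indicator; so the column is `ω(e_C)∕2·q^{2ρ+s∕2−1}·ω(−1)·B(n₁)`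
  with `B(n₁) = −[n₁ + 2 = 2d + ℓ₀ + 2ρ]` — **`finsum_stratum_G3_shell_labelledOdd_div_relIndex_beyond_zero`** (no hypothesis on `n₂` beyond the guard).
HONEST LABEL: count-neutral; R5b's Fin-3 head (slots 1, 2 by LH4-p18 (g0)), the table identity (SIG-B2b3), (β-BAL), (β), T₊ remain OPEN; `HC_CM` is proved only modulo the 7 printed
citations (2 remaining named inputs: hLiu418 = `stmt-HodgeConjecture-24832`, h413 = `stmt-HodgeConjecture-24833`) until rung 0 closes.

## References
* [Kottwitz1986BaseChangeUnits] R. E. Kottwitz, *Base change for unit elements of Hecke algebras*, Compositio Math. 60 (1986), §1 pp. 240–241 (torus orbits and stabilisers).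
* [Rogawski1990] J. D. Rogawski, *Automorphic Representations of Unitary Groups in Three Variables*, Ann. of Math. Stud. 123 (1990), §4.9 Prop. 4.9.1 (a)(b) p. 55, §4.10 p. 58.
* [LanglandsShelstad1987] R. P. Langlands, D. Shelstad, *On the definition of transfer factors*, Math. Ann. 278 (1987), §3.
* [Serre1979] J.-P. Serre, *Local Fields*, GTM 67 (1979), Ch. V §3 Prop. 5, Cor. 3; Ch. XV §2.
-/

set_option autoImplicit false

noncomputable section

namespace Summit.HodgeConjecture.HodgeConjecture.Cruxes.H413.F0P3cDyRamLabelledOddBoundaryG3SlotZero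

open Matrix WithZero
open Literature.NumberTheory.Automorphic Literature.NumberTheory.Automorphic.HermitianLattice
open Literature.NumberTheory.Automorphic.UnitaryLatticeTree Literature.NumberTheory.Automorphic.UnitaryThreeFourFrame
open Literature.NumberTheory.LocalFields Literature.NumberTheory.LocalFields.WildQuadraticDatum
open Summit.HodgeConjecture.HodgeConjecture.Cruxes.H413.F0P3cDyRamFourFramePieces
open Summit.HodgeConjecture.HodgeConjecture.Cruxes.H413.F0P3cDyRamFourFrameCensusDefs
open Summit.HodgeConjecture.HodgeConjecture.Cruxes.H413.F0P3cDyRamStageOneBDefs (mcOfRecord)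
open Summit.HodgeConjecture.HodgeConjecture.Cruxes.H413.F0P3cDyRamDiagonalTorusDefs
open Summit.HodgeConjecture.HodgeConjecture.Cruxes.H413.F0P3cDyRamDiagonalStrataDefs
open Summit.HodgeConjecture.HodgeConjecture.Cruxes.H413.F0P3cDyRamLabelledOddCountDefs
open Summit.HodgeConjecture.HodgeConjecture.Cruxes.H413.F0P3cDyRamLabelledOddBoundaryValueG3 (labelledOddCount_div_relIndex_twoSlot_latt_G3)
open Summit.HodgeConjecture.HodgeConjecture.Cruxes.H413.F0P3cDyRamLabelledOddBoundaryIndicatorsG3 (indicator_zero_latt_G3_iff)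
open Summit.HodgeConjecture.HodgeConjecture.Cruxes.H413.F0P3cDyRamLabelledOddG3OrbitDecomposition
open Summit.HodgeConjecture.HodgeConjecture.Cruxes.H413.F0P3cDyRamLabelledOddPureStrataG3Shell (shell_of_mem_stratum_G3_of_guard)
open Summit.HodgeConjecture.HodgeConjecture.Cruxes.H413.F0P3cDyRamLabelledOddBoundarySums (sum_normSign_one_add_mul_moebius_boundary sum_normSign_one_add_mul_moebius_eq_zero)
open Summit.HodgeConjecture.HodgeConjecture.Cruxes.H413.F0P3cDyRamDiagonalGluedClassRepresentatives (exists_fixed_class_representatives v_mul_map_pow)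
open Summit.HodgeConjecture.HodgeConjecture.Cruxes.H413.F0P3cDyRamDiagonalOrbitFibreCountHeads (finite_unitTorus_orbit_of_mem_normalisedStableLattices)
open Summit.HodgeConjecture.HodgeConjecture.Cruxes.H413.F0P3cDyRamStableCountTypeZero (v_diag_eq_one diag_regular)
open Summit.HodgeConjecture.HodgeConjecture.Cruxes.H413.F0P3cDyRamTowerSignToken (exists_towerSign_of_mcOfRecord_le)
open Summit.HodgeConjecture.HodgeConjecture.Cruxes.H413.F0P3cDyRamElementDatumParity (isoceles_of_isElementDatum depth_mod_two_eq_of_isElementDatum)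
open Summit.HodgeConjecture.HodgeConjecture.Cruxes.H413.F0P3cDyRamFixedCountDiagonalModel (normSign_mul_norm)
open Summit.HodgeConjecture.HodgeConjecture.Cruxes.H413.F0P3cDyRamDiagonalKappaGluedDecomposition (orbit_mass_eq_pow)
open Summit.HodgeConjecture.HodgeConjecture.Cruxes.H413.F0P3cDyRamValueClassLabelEquivariant (isTorusEquivariantLabel_valueClassLabel)
open Summit.HodgeConjecture.HodgeConjecture.Cruxes.H413.F0P3cDyRamDiagonalKappaSplitCountEval (normSign_mul_self)
open scoped Valued WithZero Matrix MatrixGroups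

variable {K : Type} [Field K] [Valued K ℤᵐ⁰] {σ : K →+* K} {ϖ : K} {d t₂ : ℕ}

/-! ## §1  The representative algebra: `S(g) = (1+g)⁻¹·e_C·(1 + κ·g∕(1+g))`, `ω(S(g))`, `ω(D(g)₀)` -/

omit [Valued K ℤᵐ⁰] in
/-- **THE TWO-SLOT UNIT ON A REPRESENTATIVE.**  With `P = π₀^{ρ+t}`, `D₀ = −P⁻¹(1+g)⁻¹`, `D₁ = P⁻¹`, `x = (1+g)⁻¹` (`g` σ-fixed):
`D₀·(π₀^{k₁}e_B − P·e_C) + D₁·(σx·x)·π₀^{k₁}e_B = (1+g)⁻¹·e_C·(1 + κ·g∕(1+g))`, `κ = −e_B·π₀^{k₁}·P⁻¹·e_C⁻¹` (a field identity). [cite: Kottwitz1986BaseChangeUnits, §1 pp. 240–241] -/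
theorem linearSum_G3_rep_eq (hϖ0 : ϖ ≠ 0) {g : K} (hσg : σ g = g) (h1g : (1 + g : K) ≠ 0) {eC : K} (heC0 : eC ≠ 0) (eB : K) (ρ t k₁ : ℕ) :
    -(((ϖ * σ ϖ) ^ (ρ + t))⁻¹ * (1 + g)⁻¹) * ((ϖ * σ ϖ) ^ k₁ * eB - (ϖ * σ ϖ) ^ (ρ + t) * eC) +
        ((ϖ * σ ϖ) ^ (ρ + t))⁻¹ * (σ (1 + g)⁻¹ * (1 + g)⁻¹) * ((ϖ * σ ϖ) ^ k₁ * eB) =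
      (1 + g)⁻¹ * eC * (1 + -(eB * (ϖ * σ ϖ) ^ k₁ * ((ϖ * σ ϖ) ^ (ρ + t))⁻¹ * eC⁻¹) * (g / (1 + g))) := by
  have hσϖ0 : σ ϖ ≠ 0 := (map_ne_zero σ).2 hϖ0
  have hP0 : (ϖ * σ ϖ) ^ (ρ + t) ≠ 0 := pow_ne_zero _ (mul_ne_zero hϖ0 hσϖ0)
  rw [map_inv₀, map_add, map_one, hσg]
  field_simp
  ring

section Signs

variable [CompleteSpace K] [Finite 𝓀[K]]

/-- **`ω(S(g)) = ω(1+g)·ω(e_C)·ω(1 + κ·g∕(1+g))`** (`|g| = |ϖ|^{2t}`, `t ≥ 1`, `2k₁ ≥ 2ρ + 2` so that `|κ·g∕(1+g)| = |ϖ|^{2k₁−2ρ} < 1`; `ω((1+g)⁻¹) = ω(1+g)`).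
[cite: Serre1979, Ch. V §3 Cor. 3; Ch. XV §2] [cite: Kottwitz1986BaseChangeUnits, §1 pp. 240–241] -/
theorem normSign_linearSum_G3_rep (hD : IsRamifiedQuadraticDatum σ ϖ d t₂) {ρ t k₁ : ℕ} (ht : 1 ≤ t) (hk : ρ + 1 ≤ k₁)
    {g : K} (hσg : σ g = g) (hg : Valued.v g = Valued.v ϖ ^ (2 * t))
    {eC : K} (hσeC : σ eC = eC) (heC1 : Valued.v eC = 1) {eB : K} (hσeB : σ eB = eB) (heB1 : Valued.v eB = 1) :
    normSign σ (-(((ϖ * σ ϖ) ^ (ρ + t))⁻¹ * (1 + g)⁻¹) * ((ϖ * σ ϖ) ^ k₁ * eB - (ϖ * σ ϖ) ^ (ρ + t) * eC) +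
        ((ϖ * σ ϖ) ^ (ρ + t))⁻¹ * (σ (1 + g)⁻¹ * (1 + g)⁻¹) * ((ϖ * σ ϖ) ^ k₁ * eB)) =
      normSign σ (1 + g) * normSign σ eC * normSign σ (1 + -(eB * (ϖ * σ ϖ) ^ k₁ * ((ϖ * σ ϖ) ^ (ρ + t))⁻¹ * eC⁻¹) * (g / (1 + g))) := by
  obtain ⟨hσ, hvσ, hϖ, -, -, -, -⟩ := id hD
  have hϖ0 : ϖ ≠ 0 := fun h0 => by rw [h0, map_zero] at hϖ; exact WithZero.coe_ne_zero hϖ.symm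
  have hϖ1 : Valued.v ϖ < 1 := by rw [hϖ, ← WithZero.exp_zero, WithZero.exp_lt_exp]; norm_num
  have hσϖ0 : σ ϖ ≠ 0 := (map_ne_zero σ).2 hϖ0
  have hP0 : (ϖ * σ ϖ) ^ (ρ + t) ≠ 0 := pow_ne_zero _ (mul_ne_zero hϖ0 hσϖ0)
  have hπσ : ∀ k : ℕ, σ ((ϖ * σ ϖ) ^ k) = (ϖ * σ ϖ) ^ k := fun k => by rw [map_pow, map_mul, hσ, mul_comm]
  have hgv : Valued.v g < 1 := by rw [hg]; exact pow_lt_one₀ zero_le hϖ1 (by omega)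
  have h1gv : Valued.v (1 + g) = 1 := Valued.v.map_one_add_of_lt hgv
  have h1g : (1 + g : K) ≠ 0 := fun h => by rw [h, map_zero] at h1gv; exact zero_ne_one h1gv
  have heC0 : eC ≠ 0 := fun h => by rw [h, map_zero] at heC1; exact zero_ne_one heC1
  have hσ1g : σ (1 + g) = 1 + g := by rw [map_add, map_one, hσg]
  rw [linearSum_G3_rep_eq hϖ0 hσg h1g heC0 eB ρ t k₁]
  -- the Möbius factor is a fixed unit
  set κ : K := -(eB * (ϖ * σ ϖ) ^ k₁ * ((ϖ * σ ϖ) ^ (ρ + t))⁻¹ * eC⁻¹) with hκdef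
  have hσκ : σ κ = κ := by rw [hκdef, map_neg, map_mul, map_mul, map_mul, map_inv₀, map_inv₀, hσeB, hπσ, hπσ, hσeC]
  have hκm1 : Valued.v (κ * (g / (1 + g))) < 1 := by
    rw [map_mul, map_div₀, h1gv, div_one, hκdef, Valuation.map_neg, map_mul, map_mul, map_mul, map_inv₀, map_inv₀, heB1, heC1, one_mul, inv_one, mul_one,
      v_mul_map_pow hvσ, v_mul_map_pow hvσ, hg, hϖ, ← WithZero.exp_nsmul, ← WithZero.exp_nsmul, ← WithZero.exp_nsmul, ← WithZero.exp_neg, ← WithZero.exp_add, ← WithZero.exp_add, ← WithZero.exp_zero, WithZero.exp_lt_exp]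
    simp only [nsmul_eq_mul]; push_cast; omega
  have hw1 : Valued.v (1 + κ * (g / (1 + g))) = 1 := Valued.v.map_one_add_of_lt hκm1
  have hw0 : (1 + κ * (g / (1 + g)) : K) ≠ 0 := fun h => by rw [h, map_zero] at hw1; exact zero_ne_one hw1
  have hσw : σ (1 + κ * (g / (1 + g))) = 1 + κ * (g / (1 + g)) := by rw [map_add, map_one, map_mul, hσκ, map_div₀, hσ1g, hσg]
  rw [normSign_mul_of_fixed hD (by rw [map_mul, map_inv₀, hσ1g, hσeC]) hσw (mul_ne_zero (inv_ne_zero h1g) heC0) hw0,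
    normSign_mul_of_fixed hD (by rw [map_inv₀, hσ1g]) hσeC (inv_ne_zero h1g) heC0]
  -- `ω((1+g)⁻¹) = ω(1+g)`: `(1+g)⁻¹ = (1+g)·((1+g)⁻¹·σ((1+g)⁻¹))`
  have e : ((1 + g)⁻¹ : K) = (1 + g) * ((1 + g)⁻¹ * σ (1 + g)⁻¹) := by rw [map_inv₀, hσ1g]; field_simp
  rw [e, normSign_mul_norm σ _ (inv_ne_zero h1g)]

/-- **`ω(D(g)₀) = ω(−1)·ω(1+g)`** for ★ p861619's polarisation `D(g)₀ = −(π₀^{ρ+t})⁻¹·(1+g)⁻¹` (`(π₀^{ρ+t})⁻¹(1+g)⁻² = N((ϖ^{ρ+t}(1+g))⁻¹)`).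
[cite: Serre1979, Ch. V §3 Cor. 3] [cite: Kottwitz1986BaseChangeUnits, §1 pp. 240–241] -/
theorem normSign_D0_G3_rep (hD : IsRamifiedQuadraticDatum σ ϖ d t₂) (ρ t : ℕ) {g : K} (hσg : σ g = g) (h1g : (1 + g : K) ≠ 0) :
    normSign σ (-(((ϖ * σ ϖ) ^ (ρ + t))⁻¹ * (1 + g)⁻¹)) = normSign σ (-1) * normSign σ (1 + g) := by
  obtain ⟨hσ, -, hϖ, -, -, -, -⟩ := id hD
  have hϖ0 : ϖ ≠ 0 := fun h0 => by rw [h0, map_zero] at hϖ; exact WithZero.coe_ne_zero hϖ.symm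
  have hσϖ0 : σ ϖ ≠ 0 := (map_ne_zero σ).2 hϖ0
  have hσ1g : σ (1 + g) = 1 + g := by rw [map_add, map_one, hσg]
  have hz0 : ((ϖ ^ (ρ + t) * (1 + g))⁻¹ : K) ≠ 0 := inv_ne_zero (mul_ne_zero (pow_ne_zero _ hϖ0) h1g)
  have e : (-(((ϖ * σ ϖ) ^ (ρ + t))⁻¹ * (1 + g)⁻¹) : K) = (-1 * (1 + g)) * ((ϖ ^ (ρ + t) * (1 + g))⁻¹ * σ (ϖ ^ (ρ + t) * (1 + g))⁻¹) := by
    rw [map_inv₀, map_mul, map_pow, hσ1g, mul_pow]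
    field_simp
  rw [e, normSign_mul_norm σ _ hz0, normSign_mul_of_fixed hD (by rw [map_neg, map_one]) hσ1g (neg_ne_zero.2 one_ne_zero) h1g]

end Signs

/-! ## §2  The per-representative slot-0 value -/

section Value

variable [CompleteSpace K] [Fintype 𝓀[K]] {α β : K} {N₀ n₁ n₂ n₃ : ℕ}

/-- **THE SLOT-0 LABELLED ODD VALUE OF `M(g)` BEYOND THE `n₁`-CELL.**  Element datum, `T = diag(α, β, 1)`, READ `2ρ + 2t + ℓ₀ = n₃`, guard `2ρ + 2 + ℓ₀ ≤ min n₁ n₂`, `2k₁ + ℓ₀ = n₁`,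
`g` σ-fixed with `|g| = |ϖ|^{2t}`, tokens `e_C` (of `β − α`, depth `ρ+t`) and `e_B` (of `β − 1`, depth `k₁`) at precision `m*`:
`m^Λ_0(M(g))∕[𝒰 : N(S̃)] = (ω(−1)ω(e_C)∕2 · [2d − 1 ≤ n₁ − (ρ+ℓ₀)] · w) · ω(1 + κ·g∕(1+g))`, `w = ((q−1)q^{⌈(ρ+2t)∕2⌉−1}·(q−1)q^{ρ−1})⁻¹` — ★ p861675 (β1) at ★ p861619's letters,
indicator by ★ p861738 (β2), signs by §1, weight ★ `stabiliserWeight_latt_G3_rep_eq`. [cite: Kottwitz1986BaseChangeUnits, §1 pp. 240–241] [cite: Rogawski1990, §4.9 Prop. 4.9.1 (a)(b) p. 55]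
[cite: LanglandsShelstad1987, §3] -/
theorem labelledOddCount_div_relIndex_G3_rep_zero (hD : IsRamifiedQuadraticDatum σ ϖ d t₂) (h2 : Valued.v (2 : K) < 1) (h2d : 2 ≤ d)
    (hE : IsElementDatum σ ϖ N₀ α β n₁ n₂ n₃) (hmc : mcOfRecord d ≤ N₀)
    (T : GL (Fin 3) K) (hT : (T : Matrix (Fin 3) (Fin 3) K) = Matrix.diagonal ![α, β, 1])
    {ρ t : ℕ} (hρ : 1 ≤ ρ) (ht : 1 ≤ t) (hP : 2 * ρ + 2 * t + d % 2 = n₃) (hguard : 2 * ρ + 2 + d % 2 ≤ min n₁ n₂)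
    (k₁ : ℕ) (hk₁ : 2 * k₁ + d % 2 = n₁) {g : K} (hσg : σ g = g) (hg : Valued.v g = Valued.v ϖ ^ (2 * t))
    {eC : K} (hσeC : σ eC = eC) (heC1 : Valued.v eC = 1)
    (heC : Valued.v ((ϖ ^ mstarOfRecord d)⁻¹ * ((β - α) * ((ϖ * σ ϖ) ^ (ρ + t))⁻¹ - eC * ((ϖ - σ ϖ) * ((ϖ * σ ϖ) ^ ((d - d % 2) / 2))⁻¹))) ≤ 1)
    {eB : K} (hσeB : σ eB = eB) (heB1 : Valued.v eB = 1)
    (heB : Valued.v ((ϖ ^ mstarOfRecord d)⁻¹ * ((β - 1) * ((ϖ * σ ϖ) ^ k₁)⁻¹ - eB * ((ϖ - σ ϖ) * ((ϖ * σ ϖ) ^ ((d - d % 2) / 2))⁻¹))) ≤ 1) :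
    (labelledOddCount σ ϖ 0 0 (valueClassLabel σ ϖ (α - 1) (β - 1) (mstarOfRecord d) d)
          (latt (!![1, 0, 0; (1 + g)⁻¹, ϖ ^ (ρ + 2 * t), 0; (1 + g)⁻¹, -(ϖ ^ (ρ + 2 * t) * g⁻¹), ϖ ^ (2 * ρ)] : Matrix (Fin 3) (Fin 3) K)) : ℚ) /
        ((((unitStabilizer (latt (!![1, 0, 0; (1 + g)⁻¹, ϖ ^ (ρ + 2 * t), 0; (1 + g)⁻¹, -(ϖ ^ (ρ + 2 * t) * g⁻¹), ϖ ^ (2 * ρ)] : Matrix (Fin 3) (Fin 3) K))).map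
            (unitNormMap σ 3)).relIndex (fixedUnitTorus σ 3) : ℕ) : ℚ) =
      ((normSign σ (-1 : K) : ℚ) * (normSign σ eC : ℚ) / 2 * (if 2 * d - 1 ≤ n₁ - (ρ + d % 2) then (1 : ℚ) else 0) *
          ((((Nat.card 𝓀[K] - 1) * Nat.card 𝓀[K] ^ ((ρ + 2 * t + 1) / 2 - 1)) * ((Nat.card 𝓀[K] - 1) * Nat.card 𝓀[K] ^ (ρ - 1)) : ℕ) : ℚ)⁻¹) *
        (normSign σ (1 + -(eB * (ϖ * σ ϖ) ^ k₁ * ((ϖ * σ ϖ) ^ (ρ + t))⁻¹ * eC⁻¹) * (g / (1 + g))) : ℚ) := by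
  obtain ⟨hσ, hvσ, hϖ, -, -, hd1, -⟩ := id hD
  haveI : Finite 𝓀[K] := Finite.of_fintype _
  have hϖ0 : ϖ ≠ 0 := fun h0 => by rw [h0, map_zero] at hϖ; exact WithZero.coe_ne_zero hϖ.symm
  have hϖ1 : Valued.v ϖ < 1 := by rw [hϖ, ← WithZero.exp_zero, WithZero.exp_lt_exp]; norm_num
  have hσϖ0 : σ ϖ ≠ 0 := (map_ne_zero σ).2 hϖ0
  have hP0 : (ϖ * σ ϖ) ^ (ρ + t) ≠ 0 := pow_ne_zero _ (mul_ne_zero hϖ0 hσϖ0)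
  have hπσ : ∀ k : ℕ, σ ((ϖ * σ ϖ) ^ k) = (ϖ * σ ϖ) ^ k := fun k => by rw [map_pow, map_mul, hσ, mul_comm]
  have hc1 : 2 * ρ + 2 + d % 2 ≤ n₁ := hguard.trans (min_le_left _ _)
  have hc2 : 2 * ρ + 2 + d % 2 ≤ n₂ := hguard.trans (min_le_right _ _)
  have hgv : Valued.v g < 1 := by rw [hg]; exact pow_lt_one₀ zero_le hϖ1 (by omega)
  have hg0 : g ≠ 0 := fun h => by rw [h, map_zero] at hg; exact (pow_ne_zero _ ((Valuation.pos_iff _).2 hϖ0).ne') hg.symm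
  have h1gv : Valued.v (1 + g) = 1 := Valued.v.map_one_add_of_lt hgv
  have h1g : (1 + g : K) ≠ 0 := fun h => by rw [h, map_zero] at h1gv; exact zero_ne_one h1gv
  have hσ1g : σ (1 + g) = 1 + g := by rw [map_add, map_one, hσg]
  -- the representative's letters and the hypotheses of ★ p861675
  have hx : Valued.v ((1 + g)⁻¹ : K) = 1 := by rw [map_inv₀, h1gv, inv_one]
  have hz : Valued.v (-(ϖ ^ (ρ + 2 * t) * g⁻¹) : K) = Valued.v (ϖ ^ ρ) := by
    rw [Valuation.map_neg, map_mul, map_inv₀, hg, map_pow, map_pow, pow_add, mul_assoc, mul_inv_cancel₀ (pow_ne_zero _ ((Valuation.pos_iff _).2 hϖ0).ne'), mul_one]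
  have hρ₁ : 2 * ρ + 2 * t ≤ n₃ := by omega
  have hρ₂ : 2 * ρ ≤ n₂ := by omega
  have hρ₃ : ρ ≤ n₁ := by omega
  have hTM := mapGL_latt_G3_rep_of_depths hvσ hϖ hE T hT ht hρ₁ hρ₂ hρ₃ hg
  have hstr := latt_G3_rep_mem_stratum_of_depths hD hE T hT hρ ht hρ₁ hρ₂ hρ₃ hσg hg
  have hV₁ := isVertexLattice_zero_latt_G3_rep hσ hvσ hϖ ρ t ht hσg hg
  obtain ⟨hlev, hnlev, hsq⟩ := shell_of_mem_stratum_G3_of_guard hD hE hmc T ρ (2 * t) hρ (by omega) hguard hP hstr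
  have hfin := finite_unitTorus_orbit_of_mem_normalisedStableLattices hϖ (v_diag_eq_one hvσ hE) (diag_regular hE) T hT hstr.1
  have hπ₀ : σ (((ϖ * σ ϖ) ^ (ρ + t))⁻¹) = ((ϖ * σ ϖ) ^ (ρ + t))⁻¹ := by rw [map_inv₀, hπσ]
  have hD₁ : ∀ j : Fin 3, σ ((![-(((ϖ * σ ϖ) ^ (ρ + t))⁻¹ * (1 + g)⁻¹), ((ϖ * σ ϖ) ^ (ρ + t))⁻¹, ((ϖ * σ ϖ) ^ (ρ + t))⁻¹ * g] : Fin 3 → K) j) =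
      (![-(((ϖ * σ ϖ) ^ (ρ + t))⁻¹ * (1 + g)⁻¹), ((ϖ * σ ϖ) ^ (ρ + t))⁻¹, ((ϖ * σ ϖ) ^ (ρ + t))⁻¹ * g] : Fin 3 → K) j ∧
      (![-(((ϖ * σ ϖ) ^ (ρ + t))⁻¹ * (1 + g)⁻¹), ((ϖ * σ ϖ) ^ (ρ + t))⁻¹, ((ϖ * σ ϖ) ^ (ρ + t))⁻¹ * g] : Fin 3 → K) j ≠ 0 := by
    intro j
    fin_cases j
    · exact ⟨by simp [map_neg, map_mul, map_inv₀, hπ₀, hσ1g], by simpa using mul_ne_zero (inv_ne_zero hP0) (inv_ne_zero h1g)⟩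
    · exact ⟨by simpa using hπ₀, by simpa using inv_ne_zero hP0⟩
    · exact ⟨by simp [map_mul, hπ₀, hσg], by simpa using mul_ne_zero (inv_ne_zero hP0) hg0⟩
  have hmsv : mstarOfRecord d = d % 2 + 2 * d - 1 := rfl
  -- ★ p861675 (β1) at slot 0
  have hval := labelledOddCount_div_relIndex_twoSlot_latt_G3 hD h2d hE hmc T hT hρ (by omega : 1 ≤ 2 * t) hx hx hz (ρ + t) (by ring)
    (by omega) k₁ hk₁ (by omega) rfl hTM hD₁ hV₁ hlev hnlev hsq hfin hσeC heC1 heC hσeB heB1 heB 0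
  rw [hmsv, hval]
  simp only [Matrix.cons_val_zero, Matrix.cons_val_one]
  -- the indicator (★ p861738 (β2)), the weight (★ p861619), the signs (§1)
  have hind := indicator_zero_latt_G3_iff hD h2 hρ (by omega : 1 ≤ 2 * t) hx hx hz hσg (by rw [map_pow]; exact hg) (by ring) (ρ + t) (by ring) k₁ hk₁
    (by omega) rfl hD₁ hV₁ hσeC heC1 hσeB heB1
  simp only [Matrix.cons_val_one, Matrix.cons_val_zero] at hind
  rw [stabiliserWeight_latt_G3_rep_eq hD hρ ht hσg hg, normSign_linearSum_G3_rep hD ht (by omega) hσg hg hσeC heC1 hσeB heB1,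
    normSign_D0_G3_rep hD ρ t hσg h1g]
  by_cases hi : 2 * d - 1 ≤ n₁ - (ρ + d % 2)
  · rw [if_pos (hind.2 hi), if_pos hi]
    simp only [Int.cast_mul, Int.cast_one]
    have h1 : (normSign σ (1 + g) : ℚ) * normSign σ (1 + g) = 1 := by exact_mod_cast normSign_mul_self σ (1 + g)
    linear_combination ((normSign σ eC : ℚ) * normSign σ (1 + -(eB * (ϖ * σ ϖ) ^ k₁ * ((ϖ * σ ϖ) ^ (ρ + t))⁻¹ * eC⁻¹) * (g / (1 + g))) * normSign σ (-1 : K) / 2 *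
      ((((Nat.card 𝓀[K] - 1) * Nat.card 𝓀[K] ^ ((ρ + 2 * t + 1) / 2 - 1)) * ((Nat.card 𝓀[K] - 1) * Nat.card 𝓀[K] ^ (ρ - 1)) : ℕ) : ℚ)⁻¹) * h1
  · rw [if_neg (fun h => hi (hind.1 h)), if_neg hi]
    simp

end Value

/-! ## §3  THEOREM A — the slot-0 column of the G₃ stratum beyond the `n₁`-cell -/

section Head

variable [CompleteSpace K] [Fintype 𝓀[K]] {α β : K} {N₀ n₁ n₂ n₃ : ℕ}

/-- **THEOREM A (R5b, SLOT 0).**  Element datum (`N₀ ≥ d`, `N₀ ≥ mcOfRecord d`), `|2| < 1`, `d ≥ 2`, `T = diag(α, β, 1)`, `ρ ≥ 1`, READ `2ρ + s + ℓ₀ = n₃`, `2 ∣ s`, tube guard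
`2ρ + 2 + ℓ₀ ≤ min n₁ n₂`, BEYOND THE `n₁`-CELL `n₁ < 2ρ + m*`, token `e_C` of `β − α` at depth `(n₃ − ℓ₀)∕2`: in the bracket currency of ★ p861354 `hbeyond` (★ p861504 §2's frame),
`Σᶠ_{M ∈ G₃(2ρ+s,2ρ+s,2ρ), shell} m^Λ_0(M)∕[𝒰 : N(S̃(M))] = ω(e_C)∕2 · q^{2ρ+s∕2−1} · ω(−1)·((q−1)·[2d+ℓ₀+2ρ ≤ n₁] − [n₁+2 = 2d+ℓ₀+2ρ])` (the first bracket is dead here).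
★ p861619 `_of_read` ∘ §2 ∘ ★ p861608 §3 (boundary `Δ₁ = 2d−2`: `−q^{⌈ρ∕2⌉−1}`; below: `0` inside the window = the indicator) ∘ ★ `orbit_mass_eq_pow`.
[cite: Kottwitz1986BaseChangeUnits, §1 pp. 240–241] [cite: Rogawski1990, §4.9 Prop. 4.9.1 (a)(b) p. 55, §4.10 p. 58] [cite: LanglandsShelstad1987, §3] [cite: Serre1979, Ch. V §3 Prop. 5, Cor. 3] -/
theorem finsum_stratum_G3_shell_labelledOdd_div_relIndex_beyond_zero (hD : IsRamifiedQuadraticDatum σ ϖ d t₂) (h2 : Valued.v (2 : K) < 1) (h2d : 2 ≤ d)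
    (hE : IsElementDatum σ ϖ N₀ α β n₁ n₂ n₃) (hN₀ : d ≤ N₀) (hmc : mcOfRecord d ≤ N₀)
    (T : GL (Fin 3) K) (hT : (T : Matrix (Fin 3) (Fin 3) K) = Matrix.diagonal ![α, β, 1]) (ρ s : ℕ) (hρ : 1 ≤ ρ)
    (hlt₁ : n₁ < 2 * ρ + mstarOfRecord d) (hP : 2 * ρ + s + d % 2 = n₃) (h2s : 2 ∣ s) (hcap : 2 * ρ + 2 + d % 2 ≤ min n₁ n₂)
    {eC : K} (hσeC : σ eC = eC) (heC1 : Valued.v eC = 1)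
    (heC : Valued.v ((ϖ ^ mstarOfRecord d)⁻¹ * ((β - α) * ((ϖ * σ ϖ) ^ ((n₃ - d % 2) / 2))⁻¹ - eC * ((ϖ - σ ϖ) * ((ϖ * σ ϖ) ^ ((d - d % 2) / 2))⁻¹))) ≤ 1) :
    ∑ᶠ M ∈ {M : Submodule 𝒪[K] (Fin 3 → K) | M ∈ stratum σ ϖ T ![2 * ρ + s, 2 * ρ + s, 2 * ρ] ∧
        (LatticeInLevel ϖ (d % 2) (Matrix.diagonal ![α - 1, β - 1, 0]) M ∧ ¬ LatticeInLevel ϖ (d % 2 + 1) (Matrix.diagonal ![α - 1, β - 1, 0]) M ∧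
          LatticeInLevel ϖ (mcOfRecord d) (Matrix.diagonal ![(α - 1) * (α - 1), (β - 1) * (β - 1), 0]) M)},
      (labelledOddCount σ ϖ 0 0 (valueClassLabel σ ϖ (α - 1) (β - 1) (mstarOfRecord d) d) M : ℚ) /
        ((((unitStabilizer M).map (unitNormMap σ 3)).relIndex (fixedUnitTorus σ 3) : ℕ) : ℚ) =
      (normSign σ eC : ℚ) / 2 * (Fintype.card 𝓀[K] : ℚ) ^ (2 * ρ + s / 2 - 1) *
        ((normSign σ (-1 : K) : ℚ) * ((if 2 * d + d % 2 + 2 * ρ ≤ n₁ then (Fintype.card 𝓀[K] : ℚ) - 1 else 0) - (if n₁ + 2 = 2 * d + d % 2 + 2 * ρ then 1 else 0))) := by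
  obtain ⟨hσ, hvσ, hϖ, hfix, hdd, hd1, -⟩ := id hD
  haveI : Finite 𝓀[K] := Finite.of_fintype _
  have hq : 1 < Nat.card 𝓀[K] := Finite.one_lt_card
  have hϖ0 : ϖ ≠ 0 := fun h0 => by rw [h0, map_zero] at hϖ; exact WithZero.coe_ne_zero hϖ.symm
  have hiso := isoceles_of_isElementDatum hD hE
  obtain ⟨hp1, -, -⟩ := depth_mod_two_eq_of_isElementDatum hD hE hN₀
  obtain ⟨-, hβ, -, -, -, hvβ, -, -, hN₁, -, -⟩ := id hE
  have hmsv : mstarOfRecord d = d % 2 + 2 * d - 1 := rfl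
  have hlt' := hlt₁
  rw [hmsv] at hlt'
  have hc1 : 2 * ρ + 2 + d % 2 ≤ n₁ := hcap.trans (min_le_left _ _)
  have hc2 : 2 * ρ + 2 + d % 2 ≤ n₂ := hcap.trans (min_le_right _ _)
  obtain ⟨t, rfl⟩ := h2s
  have ht : 1 ≤ t := by rcases hiso with ⟨h1, h2⟩ | ⟨h1, h2⟩ | ⟨h1, h2⟩ <;> omega
  have hA₁ : ¬ (2 * d + d % 2 + 2 * ρ ≤ n₁) := by omega
  rw [if_neg hA₁, show 2 * t / 2 = t by omega]
  -- the second token `e_B` (of `β − 1`, depth `k₁`), ★ p860771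
  obtain ⟨eB, hσeB, heB1, heB⟩ := exists_towerSign_of_mcOfRecord_le hD hβ hvβ hp1 (hmc.trans hN₁)
  set k₁ : ℕ := (n₁ - d % 2) / 2 with hk₁def
  have hk₁ : 2 * k₁ + d % 2 = n₁ := by omega
  have hk₃ : (n₃ - d % 2) / 2 = ρ + t := by omega
  rw [hk₃] at heC
  -- representatives (★ (iv-c)) and the orbit decomposition on the read (★ p861619)
  obtain ⟨Rs, hRfin, -, hR1, hR2, hR3⟩ := exists_fixed_class_representatives hσ hvσ hfix hϖ hdd ρ t hρ
  have hR1' : ∀ g ∈ hRfin.toFinset, σ g = g ∧ Valued.v g = Valued.v ϖ ^ (2 * t) := fun g hg => hR1 g (hRfin.mem_toFinset.1 hg)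
  have hR2' : ∀ f : K, σ f = f → Valued.v f = Valued.v ϖ ^ (2 * t) → ∃ g ∈ hRfin.toFinset, Valued.v (f - g) ≤ Valued.v ϖ ^ (ρ + 2 * t) :=
    fun f hf hvf => by obtain ⟨g, hg, h⟩ := hR2 f hf hvf; exact ⟨g, hRfin.mem_toFinset.2 hg, h⟩
  have hR3' : ∀ g ∈ hRfin.toFinset, ∀ g' ∈ hRfin.toFinset, Valued.v (g - g') ≤ Valued.v ϖ ^ (ρ + 2 * t) → g = g' :=
    fun g hg g' hg' h => hR3 g (hRfin.mem_toFinset.1 hg) g' (hRfin.mem_toFinset.1 hg') h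
  rw [finsum_stratum_G3_shell_labelledOdd_div_relIndex_eq_card_mul_sum_of_read hD h2 hE hmc T hT ρ t hρ ht hP hcap _ hR1' hR2' hR3' 0 0
      (isTorusEquivariantLabel_valueClassLabel σ ϖ (α - 1) (β - 1) (mstarOfRecord d) d),
    Finset.sum_congr rfl fun g hg => labelledOddCount_div_relIndex_G3_rep_zero hD h2 h2d hE hmc T hT hρ ht hP hcap k₁ hk₁ (hR1' g hg).1 (hR1' g hg).2
      hσeC heC1 heC hσeB heB1 heB,
    ← Finset.mul_sum, ← Int.cast_sum]
  -- the Möbius constant `κ` and its level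
  set κ : K := -(eB * (ϖ * σ ϖ) ^ k₁ * ((ϖ * σ ϖ) ^ (ρ + t))⁻¹ * eC⁻¹) with hκdef
  have hπσ : ∀ k : ℕ, σ ((ϖ * σ ϖ) ^ k) = (ϖ * σ ϖ) ^ k := fun k => by rw [map_pow, map_mul, hσ, mul_comm]
  have hσκ : σ κ = κ := by rw [hκdef, map_neg, map_mul, map_mul, map_mul, map_inv₀, map_inv₀, hσeB, hπσ, hπσ, hσeC]
  have hpw : ∀ n : ℕ, Valued.v ϖ ^ n = exp (-(n : ℤ)) := fun n => by rw [hϖ, ← WithZero.exp_nsmul, nsmul_eq_mul, mul_neg, mul_one]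
  have hκv : Valued.v κ * Valued.v ϖ ^ (2 * t) = Valued.v ϖ ^ (2 * k₁ - 2 * ρ) := by
    rw [hκdef, Valuation.map_neg, map_mul, map_mul, map_mul, map_inv₀, map_inv₀, heB1, heC1, one_mul, inv_one, mul_one, v_mul_map_pow hvσ, v_mul_map_pow hvσ]
    simp only [hpw]
    rw [← WithZero.exp_neg, ← WithZero.exp_add, ← WithZero.exp_add]
    congr 1; omega
  have hmass := orbit_mass_eq_pow hq hρ t
  have hexp : 2 * ρ + 2 * t - (ρ + 2 * t + 1) / 2 + ((ρ + 1) / 2 - 1) = 2 * ρ + t - 1 := by omega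
  by_cases hb : n₁ + 2 = 2 * d + d % 2 + 2 * ρ
  · -- AT THE BOUNDARY `Δ₁ = 2d − 2`: the R-sum is `−q^{⌈ρ∕2⌉−1}`, the indicator is on
    have hi : 2 * d - 1 ≤ n₁ - (ρ + d % 2) := by omega
    have hκb : Valued.v κ * Valued.v ϖ ^ (2 * t) = Valued.v ϖ ^ (2 * (d - 1)) := by rw [hκv]; congr 1; omega
    rw [if_pos hi, if_pos hb, sum_normSign_one_add_mul_moebius_boundary hD h2 h2d hρ ht _ hR1' hR2' hR3' hσκ hκb, Int.cast_neg, Int.cast_pow, Int.cast_natCast]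
    rw [Nat.card_eq_fintype_card] at hmass ⊢
    have hpow : (Fintype.card 𝓀[K] : ℚ) ^ (2 * ρ + 2 * t - (ρ + 2 * t + 1) / 2) * (Fintype.card 𝓀[K] : ℚ) ^ ((ρ + 1) / 2 - 1) =
        (Fintype.card 𝓀[K] : ℚ) ^ (2 * ρ + t - 1) := by rw [← pow_add, hexp]
    linear_combination (-((normSign σ (-1 : K) : ℚ) * (normSign σ eC : ℚ) / 2) * (Fintype.card 𝓀[K] : ℚ) ^ ((ρ + 1) / 2 - 1)) * hmass
      - ((normSign σ (-1 : K) : ℚ) * (normSign σ eC : ℚ) / 2) * hpow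
  · by_cases hi : 2 * d - 1 ≤ n₁ - (ρ + d % 2)
    · -- BELOW THE BOUNDARY, INSIDE THE WINDOW: the R-sum vanishes
      have hκb : Valued.v κ * Valued.v ϖ ^ (2 * t) = Valued.v ϖ ^ (2 * (k₁ - ρ)) := by rw [hκv]; congr 1; omega
      rw [if_pos hi, if_neg hb, sum_normSign_one_add_mul_moebius_eq_zero hD h2 ht (by omega : 1 ≤ k₁ - ρ) (by omega) (by omega) _ hR1' hR2' hR3' hσκ hκb]
      simp
    · -- BELOW THE WINDOW: the indicator is off
      rw [if_neg hi, if_neg hb]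
      simp

end Head

end Summit.HodgeConjecture.HodgeConjecture.Cruxes.H413.F0P3cDyRamLabelledOddBoundaryG3SlotZero

end
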